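import Summits.BirchSwinnertonDyer.BirchSwinnertonDyer.Theorems.SoloInformedSingleOrbit

/-!
# Equivariant constructors are bounded by the invariants of their source

Solo-informed kernel file 17 (session s11, census row R45; generalises file 16,
`SoloInformedSingleOrbit`).

## The algebra (proved here, sorry-free)

Let `G` be a finite group, `χ : G →* ℚˣ` a character, `ρ_W`, `ρ_V` representations of `G` on
`ℚ`-vector spaces `W` ("parameter / source module of a construction") and `V` ("points"), and
`Φ : W →ₗ[ℚ] V` a `G`-equivariant linear map ("the constructor").  Then

  `range Φ ⊓ V^χ = Φ(W^χ)`                      (`range_inf_eigenSubmodule_eq_map`)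

where `V^χ`, `W^χ` are the `χ`-eigenspaces (`eigenSubmodule`).  Consequently
`finrank (range Φ ⊓ V^χ) ≤ finrank W^χ` (`finrank_range_inf_eigenSubmodule_le`), and if the
source has no `χ`-eigenvector then the constructor contributes nothing to the `χ`-line of `V`
(`range_inf_eigenSubmodule_eq_bot`).  The proof is the averaging operator
`T_χ = ∑_h χ(h)⁻¹ ρ(h)` of file 16: it commutes with `Φ`, is `|G| • id` on `χ`-eigenvectors,
and lands in the `χ`-eigenspace.  File 16's single-orbit lemma is the case `W = ℚ[G/H]`
(a transitive permutation module), where `dim W^χ ≤ 1`.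

## The dictionary (interpretation, NOT formalised; recorded for the repair census, paper §13)

Take `V = E(H) ⊗ ℚ` for a finite Galois extension `H/ℚ` with group `G`, `χ = 1`, so
`V^G = E(ℚ) ⊗ ℚ`.  Every algebraic-point constructor in print is an equivariant `Φ` from a
source module `W` spanned by special inputs (CM points of one conductor: `W = ℚ[G/H']`;
Chow–Heegner / diagonal-cycle points: `W` = a Hecke-isotypic space of correspondences, on
which `G` acts trivially; plectic points: `W` indexed by archimedean or `p`-adic places).
(ISO) says the rational points such a `Φ` can certify span at most `dim W^G` dimensions.
For every Galois-equivariant constructor in print `dim W^G ≤ 1` (Heegner / Stark–Heegner /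
plectic points: one orbit of inputs, file 16; the elliptic Stark regulator of
Darmon–Lauder–Rotger 2015 in the adjoint case: the trivial constituent of `V_g ⊗ V_g^∨` occurs
once, and their Example 5.5 records the resulting "trivial" vanishing on a rank-two curve),
and the certificate of non-triviality of `Φ(W^G)` is in every case a FIRST central-derivative
formula `L'(E,1)·(companion central value)` (Gross–Zagier; for Chow–Heegner / diagonal-cycle
points, where `G` acts trivially and (ISO) is void, the Gross–Kudla formula of
Yuan–Zhang–Zhang through the factorisation `L(g⊗g⊗f,s) = L(f,s-1)·L(Sym² g⊗f,s)`:
"positive rank iff `L'(f,1) ≠ 0` and `L(Sym² g^σ ⊗ f,2) ≠ 0`", Darmon–Rotger–Sols 2012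
Thm 3.7; torsion in the complementary sign, Lilienfeldt arXiv:2111.14727 Thm 1.3), which
vanishes at analytic rank `≥ 2`.  Hence at analytic rank two a constructor must have a source
with `dim W^G ≥ 2` (two orbits of inputs, or a non-permutation source with two invariant
dimensions) AND a certificate for `Φ(W^G)` that is not a first central derivative — or be
non-equivariant.  This sharpens requirement (SO) of file 16.
-/

namespace Summit.BirchSwinnertonDyer.BirchSwinnertonDyer.Theorems

open scoped BigOperators

section IsotypicBound

variable {G V W : Type*} [Group G] [Fintype G]
  [AddCommGroup V] [Module ℚ V] [AddCommGroup W] [Module ℚ W]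

/-- The twisted averaging operator lands in the `χ`-eigenspace. -/
lemma twistedSum_mem_eigenSubmodule (ρ : Representation ℚ G V) (χ : G →* ℚˣ) (v : V) :
    twistedSum ρ χ v ∈ eigenSubmodule ρ χ := by
  rw [mem_eigenSubmodule]
  intro g
  rw [twistedSum_apply, map_sum, Finset.smul_sum]
  have key : ∀ h : G, ρ g ((((χ h)⁻¹ : ℚˣ) : ℚ) • ρ h v)
      = (fun h' : G => ((χ g : ℚˣ) : ℚ) • ((((χ h')⁻¹ : ℚˣ) : ℚ) • ρ h' v)) (g * h) := by
    intro h
    simp only [map_smul, map_mul, smul_smul]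
    have hρ : ρ g (ρ h v) = (ρ g * ρ h) v := rfl
    rw [hρ]
    congr 1
    rw [mul_inv, Units.val_mul, ← mul_assoc, Units.mul_inv, one_mul]
  rw [Fintype.sum_equiv (Equiv.mulLeft g) _
      (fun h' : G => ((χ g : ℚˣ) : ℚ) • ((((χ h')⁻¹ : ℚˣ) : ℚ) • ρ h' v)) (fun h => key h)]

/-- An equivariant linear map commutes with the twisted averaging operators. -/
lemma map_twistedSum (ρW : Representation ℚ G W) (ρV : Representation ℚ G V) (χ : G →* ℚˣ)
    (Φ : W →ₗ[ℚ] V) (hΦ : ∀ (g : G) (w : W), Φ (ρW g w) = ρV g (Φ w)) (w : W) :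
    Φ (twistedSum ρW χ w) = twistedSum ρV χ (Φ w) := by
  rw [twistedSum_apply, twistedSum_apply, map_sum]
  refine Finset.sum_congr rfl (fun h _ => ?_)
  rw [map_smul, hΦ]

omit [Fintype G] in
/-- The image of the source eigenspace consists of eigenvectors in the range (the easy
inclusion). -/
lemma map_eigenSubmodule_le (ρW : Representation ℚ G W) (ρV : Representation ℚ G V)
    (χ : G →* ℚˣ) (Φ : W →ₗ[ℚ] V) (hΦ : ∀ (g : G) (w : W), Φ (ρW g w) = ρV g (Φ w)) :
    (eigenSubmodule ρW χ).map Φ ≤ LinearMap.range Φ ⊓ eigenSubmodule ρV χ := by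
  rintro v ⟨w, hw, rfl⟩
  have hw' : ∀ g : G, ρW g w = ((χ g : ℚˣ) : ℚ) • w := mem_eigenSubmodule.mp hw
  refine Submodule.mem_inf.mpr ⟨LinearMap.mem_range_self Φ w, ?_⟩
  rw [mem_eigenSubmodule]
  intro g
  rw [← hΦ, hw' g, map_smul]

/-- **Isotypic bound (equality form).**  For a `G`-equivariant linear map `Φ : W → V`, the
`χ`-eigenvectors of `V` lying in the range of `Φ` are exactly the images of the
`χ`-eigenvectors of `W`. -/
theorem range_inf_eigenSubmodule_eq_map (ρW : Representation ℚ G W) (ρV : Representation ℚ G V)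
    (χ : G →* ℚˣ) (Φ : W →ₗ[ℚ] V) (hΦ : ∀ (g : G) (w : W), Φ (ρW g w) = ρV g (Φ w)) :
    LinearMap.range Φ ⊓ eigenSubmodule ρV χ = (eigenSubmodule ρW χ).map Φ := by
  refine le_antisymm ?_ (map_eigenSubmodule_le ρW ρV χ Φ hΦ)
  rintro v ⟨⟨w, rfl⟩, heig⟩
  rw [SetLike.mem_coe, mem_eigenSubmodule] at heig
  have hcard : (Fintype.card G : ℚ) ≠ 0 := by exact_mod_cast Fintype.card_ne_zero
  -- `|G| • Φ w = T_V (Φ w) = Φ (T_W w)`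
  have hT : (Fintype.card G : ℚ) • Φ w = Φ (twistedSum ρW χ w) := by
    rw [← twistedSum_apply_of_eigen ρV χ heig, map_twistedSum ρW ρV χ Φ hΦ]
  have hrepr : Φ w = Φ ((Fintype.card G : ℚ)⁻¹ • twistedSum ρW χ w) := by
    rw [map_smul, ← hT, smul_smul, inv_mul_cancel₀ hcard, one_smul]
  rw [hrepr]
  exact Submodule.mem_map_of_mem
    (Submodule.smul_mem _ _ (twistedSum_mem_eigenSubmodule ρW χ w))

/-- **Isotypic bound (rank form).**  An equivariant constructor `Φ : W → V` certifies at most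
`dim W^χ` independent `χ`-eigenvectors of `V` — however large `W` is. -/
theorem finrank_range_inf_eigenSubmodule_le [FiniteDimensional ℚ W]
    (ρW : Representation ℚ G W) (ρV : Representation ℚ G V)
    (χ : G →* ℚˣ) (Φ : W →ₗ[ℚ] V) (hΦ : ∀ (g : G) (w : W), Φ (ρW g w) = ρV g (Φ w)) :
    Module.finrank ℚ ↥(LinearMap.range Φ ⊓ eigenSubmodule ρV χ)
      ≤ Module.finrank ℚ ↥(eigenSubmodule ρW χ) := by
  rw [range_inf_eigenSubmodule_eq_map ρW ρV χ Φ hΦ]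
  exact Submodule.finrank_map_le Φ (eigenSubmodule ρW χ)

/-- **No `χ`-input, no `χ`-output.**  If the source representation has no non-zero
`χ`-eigenvector, an equivariant constructor produces no non-zero `χ`-eigenvector: in the BSD
dictionary (`χ = 1`), a constructor whose parameter module carries no `G`-invariant line
certifies no rational point over the fixed field. -/
theorem range_inf_eigenSubmodule_eq_bot (ρW : Representation ℚ G W) (ρV : Representation ℚ G V)
    (χ : G →* ℚˣ) (Φ : W →ₗ[ℚ] V) (hΦ : ∀ (g : G) (w : W), Φ (ρW g w) = ρV g (Φ w))
    (hW : eigenSubmodule ρW χ = ⊥) :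
    LinearMap.range Φ ⊓ eigenSubmodule ρV χ = ⊥ := by
  rw [range_inf_eigenSubmodule_eq_map ρW ρV χ Φ hΦ, hW, Submodule.map_bot]

/-- Invariant (`χ = 1`) reading of the rank form: the `G`-fixed vectors in the range of an
equivariant `Φ` number at most `dim W^G` independent ones. -/
theorem finrank_range_inf_invariants_le [FiniteDimensional ℚ W]
    (ρW : Representation ℚ G W) (ρV : Representation ℚ G V)
    (Φ : W →ₗ[ℚ] V) (hΦ : ∀ (g : G) (w : W), Φ (ρW g w) = ρV g (Φ w)) :
    Module.finrank ℚ ↥(LinearMap.range Φ ⊓ eigenSubmodule ρV 1)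
      ≤ Module.finrank ℚ ↥(eigenSubmodule ρW 1) :=
  finrank_range_inf_eigenSubmodule_le ρW ρV 1 Φ hΦ

omit [Fintype G] in
/-- **Trivial source action.**  If `G` acts trivially on the source (`ρW = 1`, e.g. a space of
Hecke correspondences defined over `ℚ`), every output of an equivariant constructor is
`G`-fixed: the constructor lands entirely in `V^G` and sees no other isotypic component.  (Its
outputs are then rational points whose non-triviality is, in every case in print, a first
central derivative of `L(E,s)` times a companion central value.) -/
theorem range_le_invariants_of_trivial (ρV : Representation ℚ G V) (Φ : W →ₗ[ℚ] V)
    (hΦ : ∀ (g : G) (w : W), Φ w = ρV g (Φ w)) :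
    LinearMap.range Φ ≤ eigenSubmodule ρV 1 := by
  rintro v ⟨w, rfl⟩
  rw [mem_eigenSubmodule]
  intro g
  simpa using (hΦ g w).symm

end IsotypicBound

section OrbitCount

/-! ### Orbit count: an equivariant family on a `G`-set with `k` orbits certifies `≤ k`
invariant directions

This is the quantitative form of requirement (SO) of file 16 ("a rank-two constructor over `ℚ`
must be two-orbit or non-equivariant"): with `W = ℚ[ι]` the permutation module of a finite
`G`-set `ι` and `Φ` the linear extension of an equivariant family `Q : ι → V`, (ISO) bounds the
`G`-invariants of `span (range Q)` by `dim ℚ[ι]^G ≤ #(ι/G)`. -/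

/-- The permutation representation of `G` on `ℚ[ι] = ι →₀ ℚ` (`g` sends `[i]` to `[g • i]`). -/
noncomputable def permRep (G ι : Type*) [Group G] [MulAction G ι] :
    Representation ℚ G (ι →₀ ℚ) where
  toFun g := Finsupp.lmapDomain ℚ ℚ (fun i : ι => g • i)
  map_one' := by
    apply Finsupp.lhom_ext
    intro i c
    simp [Finsupp.lmapDomain_apply, Finsupp.mapDomain_single]
  map_mul' g h := by
    apply Finsupp.lhom_ext
    intro i c
    simp [Finsupp.lmapDomain_apply, Finsupp.mapDomain_single, mul_smul]

variable {G V ι : Type*} [Group G] [Fintype G] [AddCommGroup V] [Module ℚ V]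
  [MulAction G ι]

omit [Fintype G] in
/-- `permRep` acts by pushing forward along `i ↦ g • i`. -/
lemma permRep_apply (g : G) (f : ι →₀ ℚ) :
    permRep G ι g f = Finsupp.mapDomain (fun i : ι => g • i) f := rfl

omit [Fintype G] in
/-- `permRep g` sends the basis vector `[i]` to `[g • i]`. -/
lemma permRep_single (g : G) (i : ι) (c : ℚ) :
    permRep G ι g (Finsupp.single i c) = Finsupp.single (g • i) c := by
  rw [permRep_apply, Finsupp.mapDomain_single]

omit [Fintype G] in
/-- The linear extension `ℚ[ι] → V` of a `G`-equivariant family is `G`-equivariant for the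
permutation representation. -/
lemma linearCombination_equivariant (ρ : Representation ℚ G V) (Q : ι → V)
    (hQ : ∀ (g : G) (i : ι), Q (g • i) = ρ g (Q i)) (g : G) (f : ι →₀ ℚ) :
    Finsupp.linearCombination ℚ Q (permRep G ι g f)
      = ρ g (Finsupp.linearCombination ℚ Q f) := by
  have hcomp : Finsupp.linearCombination ℚ Q ∘ₗ (permRep G ι g)
      = (ρ g : V →ₗ[ℚ] V) ∘ₗ Finsupp.linearCombination ℚ Q := by
    apply Finsupp.lhom_ext
    intro i c
    simp [permRep_single, Finsupp.linearCombination_single, hQ]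
  exact congrArg (fun L : (ι →₀ ℚ) →ₗ[ℚ] V => L f) hcomp

omit [Fintype G] in
/-- A `G`-invariant vector of the permutation module is constant on orbits. -/
lemma apply_smul_eq_of_mem_invariants {f : ι →₀ ℚ}
    (hf : f ∈ eigenSubmodule (permRep G ι) 1) (g : G) (i : ι) :
    f (g • i) = f i := by
  have hfix : permRep G ι g f = f := by
    simpa using (mem_eigenSubmodule.mp hf) g
  have happ : (permRep G ι g f) (g • i) = f i := by
    rw [permRep_apply]
    exact Finsupp.mapDomain_apply (MulAction.injective g) f i
  rw [hfix] at happ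
  exact happ

omit [Fintype G] in
/-- An invariant vector vanishing at a representative of every orbit is zero. -/
lemma eq_zero_of_apply_out_eq_zero {f : ι →₀ ℚ}
    (hf : f ∈ eigenSubmodule (permRep G ι) 1)
    (h0 : ∀ q : Quotient (MulAction.orbitRel G ι), f q.out = 0) : f = 0 := by
  ext i
  have hrel : (Quotient.mk (MulAction.orbitRel G ι) i).out ∈ MulAction.orbit G i :=
    MulAction.orbitRel_apply.mp (Quotient.mk_out i)
  obtain ⟨g, hg⟩ := hrel
  have h1 := h0 (Quotient.mk (MulAction.orbitRel G ι) i)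
  rw [← hg] at h1
  change f (g • i) = 0 at h1
  rw [apply_smul_eq_of_mem_invariants hf g i] at h1
  simpa using h1

omit [Fintype G] in
/-- The invariants of the permutation module of a finite `G`-set have dimension at most the
number of orbits. -/
theorem finrank_invariants_perm_le_card_orbits [Fintype ι] :
    Module.finrank ℚ ↥(eigenSubmodule (permRep G ι) 1)
      ≤ Nat.card (Quotient (MulAction.orbitRel G ι)) := by
  classical
  set W1 := eigenSubmodule (permRep G ι) 1 with hW1
  -- evaluation at orbit representatives
  let Ψ : (ι →₀ ℚ) →ₗ[ℚ] (Quotient (MulAction.orbitRel G ι) → ℚ) :=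
    LinearMap.pi (fun q => Finsupp.lapply q.out)
  have hinj : Function.Injective (Ψ ∘ₗ W1.subtype) := by
    rw [← LinearMap.ker_eq_bot, LinearMap.ker_eq_bot']
    rintro ⟨f, hf⟩ hzero
    have h0 : ∀ q : Quotient (MulAction.orbitRel G ι), f q.out = 0 := by
      intro q
      have := congrFun hzero q
      simpa [Ψ] using this
    exact Subtype.ext (eq_zero_of_apply_out_eq_zero hf h0)
  calc Module.finrank ℚ ↥W1
      ≤ Module.finrank ℚ (Quotient (MulAction.orbitRel G ι) → ℚ) :=
        LinearMap.finrank_le_finrank_of_injective hinj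
    _ = Nat.card (Quotient (MulAction.orbitRel G ι)) := by
        rw [Module.finrank_pi, Nat.card_eq_fintype_card]

/-- **Orbit-count bound.**  If `Q : ι → V` is `G`-equivariant on a finite `G`-set `ι`, the
`G`-invariant part of `span (range Q)` has dimension at most the number of `G`-orbits on `ι`.
In the BSD dictionary: an equivariant point constructor indexed by a Galois-set of inputs with
`k` orbits certifies at most `k` independent rational points over the fixed field; rank two
needs two orbits (file 16 is the case `k = 1`). -/
theorem finrank_span_range_inf_invariants_le_card_orbits [Fintype ι]
    (ρ : Representation ℚ G V) (Q : ι → V) (hQ : ∀ (g : G) (i : ι), Q (g • i) = ρ g (Q i)) :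
    Module.finrank ℚ ↥(Submodule.span ℚ (Set.range Q) ⊓ eigenSubmodule ρ 1)
      ≤ Nat.card (Quotient (MulAction.orbitRel G ι)) := by
  rw [← Finsupp.range_linearCombination]
  exact (finrank_range_inf_eigenSubmodule_le (permRep G ι) ρ 1
      (Finsupp.linearCombination ℚ Q) (linearCombination_equivariant ρ Q hQ)).trans
    finrank_invariants_perm_le_card_orbits

end OrbitCount

end Summit.BirchSwinnertonDyer.BirchSwinnertonDyer.Theorems
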